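import Mathlib
import Summits.ValiantsHypothesis.ValiantsHypothesis.Theorems.KPlusLogSqLawWeakLiftingTowerGraftSignedCrossingFinite

/-!
# Tower graft line — SIGNED CROSSINGS VII: REGULAR crossings (indefinite kernel forms) — the partial jump and the local signature law

Structure file for LINE (B) `Cruxes/WeakLifting/Lines/tower_graft.lean` (crux `WeakLifting` = stmt-ValiantsHypothesis-19561),
seventh of the SIGNED-CROSSING series.  Files II–VI treat roots whose kernel crossing form `vᵀ(H′ t)v` is DEFINITE on `ker H(t)` (all
kernel eigenvalues cross the same way).  A REGULAR crossing only asks the kernel form to be NONDEGENERATE: `k₊` kernel directions on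
which it is positive, `k₋` on which it is negative, `k₊ + k₋ = ν₀(t)`.  Then `k₊` eigenvalues cross upward and `k₋` downward, and the
root contributes its SIGNATURE `k₊ − k₋` to the spectral flow (Robbin–Salamon).  This file: the static and local halves.

§1 ★ `exists_negCount_add_card_le_of_near_partialTransversal` — THE PARTIAL JUMP: `A` real symmetric, `A′` any, `Q : Matrix ι κ ℝ` with
   columns in `ker A` on whose span `A′` is positive (`(Qc)ᵀA′(Qc) > 0`, `c ≠ 0`) ⇒ `∃ μ > 0, s₀ > 0`: for `0 < s ≤ s₀` every real symmetric `M`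
   with `Σ|M − (A − s•A′)| < μ·s` has `ν₋(A) + |κ| ≤ #{λ_i(M) < 0}` (trial subspace = negative eigen-frame of `A` ⊕ `col Q`, `Matrix.fromCols`;
   Finsler–Debreu margin of file II).  File II's jump is the case `col Q = ker A`.
§2 local laws at a point `t` of a differentiable family (`hd`), for a frame `Q` in `ker H(t)`: `eventually_negCount_add_card_le_left`
   (`H′ t` positive on `col Q` ⇒ `ν₋(t) + |κ| ≤ ν₋(u)` just left of `t`), `eventually_negCount_add_card_le_right` (`H′ t` negative on `col Q`
   ⇒ the same just right of `t`), and their `ν₊` mirrors `eventually_posCount_add_card_le_left/right`.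
§3 ★★ THE LOCAL SIGNATURE LAW `eventually_negCount_eq_left_of_regular` / `…_right_of_regular`: frames `Q₊ : Matrix ι κp ℝ`, `Q₋ : Matrix ι κm ℝ`
   in `ker H(t)` with `H′ t` positive on `col Q₊`, negative on `col Q₋`, and `|κp| + |κm| = ν₀(t)` (a regular crossing, split by the user) ⇒
   `ν₋(u) = ν₋(t) + |κp|` just left of `t` and `ν₋(u) = ν₋(t) + |κm|` just right of `t`; hence the root is isolated
   (`eventually_det_ne_zero_of_regular`).  File VIII assembles these into «spectral flow = Σ signatures».
READING FOR THE LINE (honest): for a graft `G + u^D S` the kernel form is minus the CO-EULER BASE form on `ker`; at a root with a multi-dimensional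
kernel on which the base is indefinite but nondegenerate, the root contributes the signature of (minus) the base on the kernel.  Degenerate
(isotropic) kernels — the folds of memo T3 — remain outside.  Zero stub credit; S4/S5, TowerB, WeakLifting, Conjecture B, 18050, VP ≠ VNP
untouched.  Def-free; Mathlib + files I–VI.  Seat: prover val-sym-lift-p2 g24, `--supports stmt-ValiantsHypothesis-19561 --as helper`.
[folklore: Robbin–Salamon, *The spectral flow and the Maslov index*, Bull. LMS 27 (1995), crossing forms at regular crossings — the
finite-dimensional symmetric case; the packaging for the line is this work]
-/

-- `Summit.ValiantsHypothesis.ValiantsHypothesis.…` repeats a component by the D-0017 layout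
-- (single-conjunct summit), which the `dupNamespace` linter flags; the name is mandated.
set_option linter.dupNamespace false
set_option autoImplicit false

namespace Summit.ValiantsHypothesis.ValiantsHypothesis.Theorems.KPlusLogSqLaw.TowerGraft

open Matrix Finset Filter
open scoped BigOperators Topology
open Literature.Analysis.Matrix (EigenvalueCount.card_le_card_eigenvalues_lt)
open Literature.Algebra.Polynomial.MiddleMatrixSignature (card_eigenvalues_neg_add_zero_add_pos)

namespace SignedCrossing

variable {ι : Type} [Fintype ι] [DecidableEq ι] {κ : Type} [Fintype κ]

/-! ## §1 The partial jump -/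

omit [DecidableEq ι] [Fintype κ] in
/-- `|x + y|² ≤ 2|x|² + 2|y|²`. [folklore] -/
theorem dotProduct_add_self_le (x y : ι → ℝ) : (x + y) ⬝ᵥ (x + y) ≤ 2 * (x ⬝ᵥ x) + 2 * (y ⬝ᵥ y) := by
  have h : 0 ≤ (x - y) ⬝ᵥ (x - y) := by
    unfold dotProduct
    exact Finset.sum_nonneg fun i _ => mul_self_nonneg _
  rw [sub_dotProduct, dotProduct_sub, dotProduct_sub] at h
  rw [add_dotProduct, dotProduct_add, dotProduct_add, dotProduct_comm y x]
  rw [dotProduct_comm y x] at h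
  linarith

omit [DecidableEq ι] in
/-- the squared length of `Qc` is at most `Σ|QᵀQ| · (c ⬝ c)`. [folklore] -/
theorem mulVec_dotProduct_self_le (Q : Matrix ι κ ℝ) (c : κ → ℝ) :
    (Q *ᵥ c) ⬝ᵥ (Q *ᵥ c) ≤ (∑ i, ∑ j, |(Qᵀ * Q) i j|) * (c ⬝ᵥ c) := by
  have h : c ⬝ᵥ (Qᵀ * Q) *ᵥ c = (Q *ᵥ c) ⬝ᵥ (Q *ᵥ c) := by
    rw [← Matrix.mulVec_mulVec, dotProduct_mulVec, vecMul_transpose]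
  rw [← h]
  exact (le_abs_self _).trans (abs_dotProduct_mulVec_le _ c)

/-- **THE PARTIAL JUMP.**  `A` real symmetric, `A′` any real matrix, `Q : Matrix ι κ ℝ` with every column combination in `ker A` and
`(Qc)ᵀA′(Qc) > 0` for `c ≠ 0`.  Then `∃ μ > 0, s₀ > 0` such that for `0 < s ≤ s₀` every real symmetric `M` with `Σ|M − (A − s•A′)| < μ·s` has
at least `ν₋(A) + |κ|` negative eigenvalues. [folklore: first-order perturbation on part of the kernel; packaging this work] -/
theorem exists_negCount_add_card_le_of_near_partialTransversal {A : Matrix ι ι ℝ} (hA : A.IsHermitian) (A' : Matrix ι ι ℝ)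
    (Q : Matrix ι κ ℝ) (hQker : ∀ c : κ → ℝ, A *ᵥ (Q *ᵥ c) = 0)
    (hQpos : ∀ c : κ → ℝ, c ≠ 0 → 0 < (Q *ᵥ c) ⬝ᵥ A' *ᵥ (Q *ᵥ c)) :
    ∃ μ s₀ : ℝ, 0 < μ ∧ 0 < s₀ ∧ ∀ (s : ℝ), 0 < s → s ≤ s₀ → ∀ (M : Matrix ι ι ℝ) (hM : M.IsHermitian),
      (∑ i, ∑ j, |(M - (A - s • A')) i j|) < μ * s →
      (univ.filter fun i => hA.eigenvalues i < 0).card + Fintype.card κ ≤ (univ.filter fun i => hM.eigenvalues i < 0).card := by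
  classical
  let p : ℝ → Prop := fun x => x < 0
  let V : Matrix ι {i // p (hA.eigenvalues i)} ℝ := Matrix.of fun x j => (hA.eigenvectorBasis j.1).ofLp x
  let V' : Matrix ι ({i // p (hA.eigenvalues i)} ⊕ κ) ℝ := Matrix.fromCols V Q
  have hV' : ∀ c : {i // p (hA.eigenvalues i)} ⊕ κ → ℝ, V' *ᵥ c = V *ᵥ (c ∘ Sum.inl) + Q *ᵥ (c ∘ Sum.inr) := fun c =>
    Matrix.fromCols_mulVec V Q c
  have hcc : ∀ c : {i // p (hA.eigenvalues i)} ⊕ κ → ℝ, c ⬝ᵥ c = (c ∘ Sum.inl) ⬝ᵥ (c ∘ Sum.inl) + (c ∘ Sum.inr) ⬝ᵥ (c ∘ Sum.inr) := by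
    intro c
    unfold dotProduct
    rw [Fintype.sum_sum_type]
    rfl
  -- symmetric `A`: `x ⬝ A y = (A x) ⬝ y`
  have hsymm : ∀ x y : ι → ℝ, x ⬝ᵥ A *ᵥ y = (A *ᵥ x) ⬝ᵥ y := by
    intro x y
    rw [dotProduct_mulVec, ← Matrix.mulVec_transpose, Literature.Analysis.Matrix.KyFan.transpose_eq hA]
  -- the form of `A` on the extended frame only sees the eigen part
  have hAform : ∀ c : {i // p (hA.eigenvalues i)} ⊕ κ → ℝ,
      (V' *ᵥ c) ⬝ᵥ A *ᵥ (V' *ᵥ c) = ∑ j, hA.eigenvalues j.1 * (c ∘ Sum.inl) j ^ 2 := by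
    intro c
    rw [hV', Matrix.mulVec_add, hQker, add_zero, add_dotProduct, frame_mulVec_dotProduct_mulVec hA p,
      hsymm (Q *ᵥ (c ∘ Sum.inr)), hQker, zero_dotProduct, add_zero]
  -- compressions
  set B : Matrix ({i // p (hA.eigenvalues i)} ⊕ κ) ({i // p (hA.eigenvalues i)} ⊕ κ) ℝ := -(V'ᵀ * A * V') with hBdef
  set P : Matrix ({i // p (hA.eigenvalues i)} ⊕ κ) ({i // p (hA.eigenvalues i)} ⊕ κ) ℝ := V'ᵀ * A' * V' with hPdef
  have hcompr : ∀ (N : Matrix ι ι ℝ) (c : {i // p (hA.eigenvalues i)} ⊕ κ → ℝ),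
      c ⬝ᵥ (V'ᵀ * N * V') *ᵥ c = (V' *ᵥ c) ⬝ᵥ N *ᵥ (V' *ᵥ c) := by
    intro N c
    rw [← Matrix.mulVec_mulVec, ← Matrix.mulVec_mulVec, dotProduct_mulVec, vecMul_transpose]
  have hBform : ∀ c, c ⬝ᵥ B *ᵥ c = -∑ j, hA.eigenvalues j.1 * (c ∘ Sum.inl) j ^ 2 := by
    intro c
    rw [hBdef, Matrix.neg_mulVec, dotProduct_neg, hcompr, hAform]
  have hBherm : B.IsHermitian := by
    rw [hBdef]
    refine Matrix.IsHermitian.neg ?_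
    have h1 := Matrix.isHermitian_conjTranspose_mul_mul V' hA
    rwa [Matrix.conjTranspose_eq_transpose_of_trivial] at h1
  have hBpsd : B.PosSemidef := by
    refine Matrix.PosSemidef.of_dotProduct_mulVec_nonneg hBherm fun c => ?_
    rw [star_trivial, hBform, ← Finset.sum_neg_distrib]
    exact Finset.sum_nonneg fun j _ => by
      have h1 : hA.eigenvalues j.1 < 0 := j.2
      nlinarith [sq_nonneg ((c ∘ Sum.inl) j)]
  -- `P` is positive on `ker B`: there the eigen part vanishes and `V'c = Qc₂` with `c₂ ≠ 0`
  have hPker : ∀ c : {i // p (hA.eigenvalues i)} ⊕ κ → ℝ, c ≠ 0 → B *ᵥ c = 0 → 0 < c ⬝ᵥ P *ᵥ c := by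
    intro c hc hBc
    have h1 : ∀ j, (c ∘ Sum.inl) j = 0 := by
      have hsum : ∑ j, -(hA.eigenvalues j.1 * (c ∘ Sum.inl) j ^ 2) = 0 := by
        have h0 : c ⬝ᵥ B *ᵥ c = 0 := by rw [hBc, dotProduct_zero]
        rw [hBform, ← Finset.sum_neg_distrib] at h0
        exact h0
      have hnn : ∀ j ∈ (univ : Finset {i // p (hA.eigenvalues i)}), 0 ≤ -(hA.eigenvalues j.1 * (c ∘ Sum.inl) j ^ 2) :=
        fun j _ => by
          have h1 : hA.eigenvalues j.1 < 0 := j.2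
          nlinarith [sq_nonneg ((c ∘ Sum.inl) j)]
      intro j
      have hj := (Finset.sum_eq_zero_iff_of_nonneg hnn).mp hsum j (Finset.mem_univ j)
      have hlam : hA.eigenvalues j.1 < 0 := j.2
      have hsq : (c ∘ Sum.inl) j ^ 2 = 0 := by nlinarith [sq_nonneg ((c ∘ Sum.inl) j)]
      exact pow_eq_zero_iff (n := 2) (by norm_num) |>.mp hsq
    have h1' : (c ∘ Sum.inl) = 0 := funext h1
    have h2 : c ∘ Sum.inr ≠ 0 := by
      intro h0
      apply hc
      funext x
      rcases x with j | k
      · exact h1 j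
      · exact congrFun h0 k
    have hV'c : V' *ᵥ c = Q *ᵥ (c ∘ Sum.inr) := by rw [hV', h1', Matrix.mulVec_zero, zero_add]
    rw [hPdef, hcompr, hV'c]
    exact hQpos _ h2
  obtain ⟨α, μ, hα, hμ, hDeb⟩ := exists_margin_of_posDef_on_ker B P hBpsd hPker
  -- size control of the extended frame: `|V'c|² ≤ C (c ⬝ c)`
  set C : ℝ := 2 * (1 + ∑ i, ∑ j, |(Qᵀ * Q) i j|) with hCdef
  have hCpos : 0 < C := by rw [hCdef]; positivity
  have hsize : ∀ c : {i // p (hA.eigenvalues i)} ⊕ κ → ℝ, (V' *ᵥ c) ⬝ᵥ (V' *ᵥ c) ≤ C * (c ⬝ᵥ c) := by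
    intro c
    rw [hV', hcc]
    have h1 := dotProduct_add_self_le (V *ᵥ (c ∘ Sum.inl)) (Q *ᵥ (c ∘ Sum.inr))
    rw [frame_mulVec_dotProduct_self hA p] at h1
    have h2 := mulVec_dotProduct_self_le Q (c ∘ Sum.inr)
    have h3 : 0 ≤ (c ∘ Sum.inl) ⬝ᵥ (c ∘ Sum.inl) := by
      unfold dotProduct; exact Finset.sum_nonneg fun i _ => mul_self_nonneg _
    have h4 : 0 ≤ (c ∘ Sum.inr) ⬝ᵥ (c ∘ Sum.inr) := by
      unfold dotProduct; exact Finset.sum_nonneg fun i _ => mul_self_nonneg _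
    have h5 : 0 ≤ ∑ i, ∑ j, |(Qᵀ * Q) i j| := by positivity
    rw [hCdef]
    nlinarith
  refine ⟨μ / C, 1 / (α + 1), by positivity, by positivity, fun s hs hs₀ M hM hnear => ?_⟩
  rw [← card_frame hA p, ← Fintype.card_sum]
  refine EigenvalueCount.card_le_card_eigenvalues_lt hM V' fun c hc => ?_
  rw [zero_mul]
  have hcc0 : 0 < c ⬝ᵥ c := by
    have h1 := dotProduct_star_self_pos_iff.mpr hc
    simpa using h1
  have hsplit : (V' *ᵥ c) ⬝ᵥ M *ᵥ (V' *ᵥ c) =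
      -(c ⬝ᵥ B *ᵥ c) - s * (c ⬝ᵥ P *ᵥ c) + (V' *ᵥ c) ⬝ᵥ (M - (A - s • A')) *ᵥ (V' *ᵥ c) := by
    rw [hBdef, hPdef, Matrix.neg_mulVec, dotProduct_neg, hcompr, hcompr, neg_neg, Matrix.sub_mulVec, dotProduct_sub,
      Matrix.sub_mulVec, dotProduct_sub, Matrix.smul_mulVec, dotProduct_smul, smul_eq_mul]
    ring
  have hE : (V' *ᵥ c) ⬝ᵥ (M - (A - s • A')) *ᵥ (V' *ᵥ c) ≤ (∑ i, ∑ j, |(M - (A - s • A')) i j|) * (C * (c ⬝ᵥ c)) :=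
    ((le_abs_self _).trans (abs_dotProduct_mulVec_le _ (V' *ᵥ c))).trans
      (mul_le_mul_of_nonneg_left (hsize c) (Finset.sum_nonneg fun i _ => Finset.sum_nonneg fun j _ => abs_nonneg _))
  have hB0 : 0 ≤ c ⬝ᵥ B *ᵥ c := by simpa using hBpsd.dotProduct_mulVec_nonneg c
  have hDc := hDeb c
  have hsα : s * α ≤ 1 := by
    have h1 : s * (α + 1) ≤ 1 := by
      calc s * (α + 1) ≤ 1 / (α + 1) * (α + 1) := mul_le_mul_of_nonneg_right hs₀ (by positivity)
        _ = 1 := by field_simp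
    nlinarith [hs.le]
  have hkey : s * (μ * (c ⬝ᵥ c)) ≤ c ⬝ᵥ B *ᵥ c + s * (c ⬝ᵥ P *ᵥ c) := by
    have h1 : s * (μ * (c ⬝ᵥ c)) ≤ s * (c ⬝ᵥ P *ᵥ c) + s * α * (c ⬝ᵥ B *ᵥ c) := by nlinarith [hs.le]
    nlinarith
  have hmul : (∑ i, ∑ j, |(M - (A - s • A')) i j|) * (C * (c ⬝ᵥ c)) < μ / C * s * (C * (c ⬝ᵥ c)) :=
    mul_lt_mul_of_pos_right hnear (by positivity)
  have hsimp : μ / C * s * (C * (c ⬝ᵥ c)) = s * (μ * (c ⬝ᵥ c)) := by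
    field_simp
  rw [hsimp] at hmul
  rw [hsplit]
  linarith

/-! ## §2 One-sided local bounds from a frame in the kernel -/

section Local

/-- **left bound**: `H′ t` positive on a frame `Q` in `ker H(t)` ⇒ `ν₋(t) + |κ| ≤ ν₋(u)` for `u < t` near `t`. [this work] -/
theorem eventually_negCount_add_card_le_left (H : ℝ → Matrix ι ι ℝ) (hH : ∀ u, (H u).IsHermitian) (t : ℝ) (H' : ℝ → Matrix ι ι ℝ)
    (hd : ∀ i j, HasDerivAt (fun u => H u i j) (H' t i j) t) (Q : Matrix ι κ ℝ) (hQker : ∀ c : κ → ℝ, H t *ᵥ (Q *ᵥ c) = 0)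
    (hQpos : ∀ c : κ → ℝ, c ≠ 0 → 0 < (Q *ᵥ c) ⬝ᵥ H' t *ᵥ (Q *ᵥ c)) :
    ∀ᶠ u in 𝓝[<] t, (univ.filter fun i => (hH t).eigenvalues i < 0).card + Fintype.card κ ≤
      (univ.filter fun i => (hH u).eigenvalues i < 0).card := by
  obtain ⟨μ, s₀, hμ, hs₀, hjump⟩ := exists_negCount_add_card_le_of_near_partialTransversal (hH t) (H' t) Q hQker hQpos
  have hrem := eventually_sum_abs_remainder_le H t H' hd (half_pos hμ)
  have hwin : ∀ᶠ u in 𝓝[<] t, t - s₀ < u ∧ u < t := Ioo_mem_nhdsLT (by linarith)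
  refine ((hrem.filter_mono nhdsWithin_le_nhds).and hwin).mono fun u ⟨hru, hu1, hu2⟩ => ?_
  refine hjump (t - u) (by linarith) (by linarith) (H u) (hH u) ?_
  have he : H t - (t - u) • H' t = H t + (u - t) • H' t := by rw [sub_eq_add_neg, ← neg_smul, neg_sub]
  rw [he]
  have habs : |u - t| = t - u := by rw [abs_sub_comm]; exact abs_of_pos (by linarith)
  rw [habs] at hru
  have : μ / 2 * (t - u) < μ * (t - u) := by nlinarith
  linarith

/-- **right bound**: `H′ t` NEGATIVE on a frame `Q` in `ker H(t)` ⇒ `ν₋(t) + |κ| ≤ ν₋(u)` for `u > t` near `t`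
(`H u ≈ H t − s•(−H′ t)` with `s = u − t`). [this work] -/
theorem eventually_negCount_add_card_le_right (H : ℝ → Matrix ι ι ℝ) (hH : ∀ u, (H u).IsHermitian) (t : ℝ) (H' : ℝ → Matrix ι ι ℝ)
    (hd : ∀ i j, HasDerivAt (fun u => H u i j) (H' t i j) t) (Q : Matrix ι κ ℝ) (hQker : ∀ c : κ → ℝ, H t *ᵥ (Q *ᵥ c) = 0)
    (hQneg : ∀ c : κ → ℝ, c ≠ 0 → (Q *ᵥ c) ⬝ᵥ H' t *ᵥ (Q *ᵥ c) < 0) :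
    ∀ᶠ u in 𝓝[>] t, (univ.filter fun i => (hH t).eigenvalues i < 0).card + Fintype.card κ ≤
      (univ.filter fun i => (hH u).eigenvalues i < 0).card := by
  have hQpos : ∀ c : κ → ℝ, c ≠ 0 → 0 < (Q *ᵥ c) ⬝ᵥ (-H' t) *ᵥ (Q *ᵥ c) := fun c hc => by
    rw [Matrix.neg_mulVec, dotProduct_neg]
    exact neg_pos.mpr (hQneg c hc)
  obtain ⟨μ, s₀, hμ, hs₀, hjump⟩ := exists_negCount_add_card_le_of_near_partialTransversal (hH t) (-H' t) Q hQker hQpos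
  have hrem := eventually_sum_abs_remainder_le H t H' hd (half_pos hμ)
  have hwin : ∀ᶠ u in 𝓝[>] t, t < u ∧ u < t + s₀ := Ioo_mem_nhdsGT (by linarith)
  refine ((hrem.filter_mono nhdsWithin_le_nhds).and hwin).mono fun u ⟨hru, hu1, hu2⟩ => ?_
  refine hjump (u - t) (by linarith) (by linarith) (H u) (hH u) ?_
  have he : H t - (u - t) • (-H' t) = H t + (u - t) • H' t := by rw [smul_neg, sub_neg_eq_add]
  rw [he]
  have habs : |u - t| = u - t := abs_of_pos (by linarith)
  rw [habs] at hru
  have : μ / 2 * (u - t) < μ * (u - t) := by nlinarith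
  linarith

/-- `ν₊` mirror, left: `H′ t` NEGATIVE on a frame in `ker H(t)` ⇒ `ν₊(t) + |κ| ≤ ν₊(u)` for `u < t` near `t`. [this work] -/
theorem eventually_posCount_add_card_le_left (H : ℝ → Matrix ι ι ℝ) (hH : ∀ u, (H u).IsHermitian) (t : ℝ) (H' : ℝ → Matrix ι ι ℝ)
    (hd : ∀ i j, HasDerivAt (fun u => H u i j) (H' t i j) t) (Q : Matrix ι κ ℝ) (hQker : ∀ c : κ → ℝ, H t *ᵥ (Q *ᵥ c) = 0)
    (hQneg : ∀ c : κ → ℝ, c ≠ 0 → (Q *ᵥ c) ⬝ᵥ H' t *ᵥ (Q *ᵥ c) < 0) :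
    ∀ᶠ u in 𝓝[<] t, (univ.filter fun i => 0 < (hH t).eigenvalues i).card + Fintype.card κ ≤
      (univ.filter fun i => 0 < (hH u).eigenvalues i).card := by
  have hH' : ∀ u, (-H u).IsHermitian := fun u => (hH u).neg
  have hd' : ∀ i j, HasDerivAt (fun u => (-H u) i j) ((fun u => -H' u) t i j) t := fun i j => (hd i j).neg
  have hQker' : ∀ c : κ → ℝ, (-H t) *ᵥ (Q *ᵥ c) = 0 := fun c => by rw [Matrix.neg_mulVec, hQker, neg_zero]
  have hQpos : ∀ c : κ → ℝ, c ≠ 0 → 0 < (Q *ᵥ c) ⬝ᵥ (-H' t) *ᵥ (Q *ᵥ c) := fun c hc => by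
    rw [Matrix.neg_mulVec, dotProduct_neg]
    exact neg_pos.mpr (hQneg c hc)
  have h := eventually_negCount_add_card_le_left (fun u => -H u) hH' t (fun u => -H' u) hd' Q hQker' hQpos
  refine h.mono fun u hu => ?_
  rwa [(negCount_neg_eq_posCount (hH t) (hH' t)).1, (negCount_neg_eq_posCount (hH u) (hH' u)).1] at hu

/-- `ν₊` mirror, right: `H′ t` POSITIVE on a frame in `ker H(t)` ⇒ `ν₊(t) + |κ| ≤ ν₊(u)` for `u > t` near `t`. [this work] -/
theorem eventually_posCount_add_card_le_right (H : ℝ → Matrix ι ι ℝ) (hH : ∀ u, (H u).IsHermitian) (t : ℝ) (H' : ℝ → Matrix ι ι ℝ)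
    (hd : ∀ i j, HasDerivAt (fun u => H u i j) (H' t i j) t) (Q : Matrix ι κ ℝ) (hQker : ∀ c : κ → ℝ, H t *ᵥ (Q *ᵥ c) = 0)
    (hQpos : ∀ c : κ → ℝ, c ≠ 0 → 0 < (Q *ᵥ c) ⬝ᵥ H' t *ᵥ (Q *ᵥ c)) :
    ∀ᶠ u in 𝓝[>] t, (univ.filter fun i => 0 < (hH t).eigenvalues i).card + Fintype.card κ ≤
      (univ.filter fun i => 0 < (hH u).eigenvalues i).card := by
  have hH' : ∀ u, (-H u).IsHermitian := fun u => (hH u).neg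
  have hd' : ∀ i j, HasDerivAt (fun u => (-H u) i j) ((fun u => -H' u) t i j) t := fun i j => (hd i j).neg
  have hQker' : ∀ c : κ → ℝ, (-H t) *ᵥ (Q *ᵥ c) = 0 := fun c => by rw [Matrix.neg_mulVec, hQker, neg_zero]
  have hQneg : ∀ c : κ → ℝ, c ≠ 0 → (Q *ᵥ c) ⬝ᵥ (-H' t) *ᵥ (Q *ᵥ c) < 0 := fun c hc => by
    rw [Matrix.neg_mulVec, dotProduct_neg]
    exact neg_neg_of_pos (hQpos c hc)
  have h := eventually_negCount_add_card_le_right (fun u => -H u) hH' t (fun u => -H' u) hd' Q hQker' hQneg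
  refine h.mono fun u hu => ?_
  rwa [(negCount_neg_eq_posCount (hH t) (hH' t)).1, (negCount_neg_eq_posCount (hH u) (hH' u)).1] at hu

/-! ## §3 The local signature law at a regular crossing -/

variable {κp κm : Type} [Fintype κp] [Fintype κm]

/-- **local signature law, left side**: a regular crossing at `t` split as `Q₊` (positive kernel directions of `H′ t`) and `Q₋` (negative ones)
with `|κp| + |κm| = ν₀(t)` ⇒ `ν₋(u) = ν₋(t) + |κp|` for `u < t` near `t`. [folklore: Robbin–Salamon; packaging this work] -/
theorem eventually_negCount_eq_left_of_regular (H : ℝ → Matrix ι ι ℝ) (hH : ∀ u, (H u).IsHermitian) (t : ℝ) (H' : ℝ → Matrix ι ι ℝ)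
    (hd : ∀ i j, HasDerivAt (fun u => H u i j) (H' t i j) t)
    (Qp : Matrix ι κp ℝ) (hQpker : ∀ c : κp → ℝ, H t *ᵥ (Qp *ᵥ c) = 0)
    (hQp : ∀ c : κp → ℝ, c ≠ 0 → 0 < (Qp *ᵥ c) ⬝ᵥ H' t *ᵥ (Qp *ᵥ c))
    (Qm : Matrix ι κm ℝ) (hQmker : ∀ c : κm → ℝ, H t *ᵥ (Qm *ᵥ c) = 0)
    (hQm : ∀ c : κm → ℝ, c ≠ 0 → (Qm *ᵥ c) ⬝ᵥ H' t *ᵥ (Qm *ᵥ c) < 0)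
    (hreg : Fintype.card κp + Fintype.card κm = (univ.filter fun i => (hH t).eigenvalues i = 0).card) :
    ∀ᶠ u in 𝓝[<] t, (univ.filter fun i => (hH u).eigenvalues i < 0).card =
      (univ.filter fun i => (hH t).eigenvalues i < 0).card + Fintype.card κp := by
  have h1 := eventually_negCount_add_card_le_left H hH t H' hd Qp hQpker hQp
  have h2 := eventually_posCount_add_card_le_left H hH t H' hd Qm hQmker hQm
  refine (h1.and h2).mono fun u ⟨hu1, hu2⟩ => ?_
  have := card_eigenvalues_neg_add_zero_add_pos (hH t)
  have := card_eigenvalues_neg_add_zero_add_pos (hH u)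
  omega

/-- **local signature law, right side**: same data ⇒ `ν₋(u) = ν₋(t) + |κm|` for `u > t` near `t`; so across the root
`ν₋` drops by the SIGNATURE `|κp| − |κm|` of the kernel crossing form. [folklore: Robbin–Salamon; packaging this work] -/
theorem eventually_negCount_eq_right_of_regular (H : ℝ → Matrix ι ι ℝ) (hH : ∀ u, (H u).IsHermitian) (t : ℝ) (H' : ℝ → Matrix ι ι ℝ)
    (hd : ∀ i j, HasDerivAt (fun u => H u i j) (H' t i j) t)
    (Qp : Matrix ι κp ℝ) (hQpker : ∀ c : κp → ℝ, H t *ᵥ (Qp *ᵥ c) = 0)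
    (hQp : ∀ c : κp → ℝ, c ≠ 0 → 0 < (Qp *ᵥ c) ⬝ᵥ H' t *ᵥ (Qp *ᵥ c))
    (Qm : Matrix ι κm ℝ) (hQmker : ∀ c : κm → ℝ, H t *ᵥ (Qm *ᵥ c) = 0)
    (hQm : ∀ c : κm → ℝ, c ≠ 0 → (Qm *ᵥ c) ⬝ᵥ H' t *ᵥ (Qm *ᵥ c) < 0)
    (hreg : Fintype.card κp + Fintype.card κm = (univ.filter fun i => (hH t).eigenvalues i = 0).card) :
    ∀ᶠ u in 𝓝[>] t, (univ.filter fun i => (hH u).eigenvalues i < 0).card =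
      (univ.filter fun i => (hH t).eigenvalues i < 0).card + Fintype.card κm := by
  have h1 := eventually_negCount_add_card_le_right H hH t H' hd Qm hQmker hQm
  have h2 := eventually_posCount_add_card_le_right H hH t H' hd Qp hQpker hQp
  refine (h1.and h2).mono fun u ⟨hu1, hu2⟩ => ?_
  have := card_eigenvalues_neg_add_zero_add_pos (hH t)
  have := card_eigenvalues_neg_add_zero_add_pos (hH u)
  omega

/-- **a regular crossing is isolated** (both sides). [folklore] -/
theorem eventually_det_ne_zero_of_regular (H : ℝ → Matrix ι ι ℝ) (hH : ∀ u, (H u).IsHermitian) (t : ℝ) (H' : ℝ → Matrix ι ι ℝ)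
    (hd : ∀ i j, HasDerivAt (fun u => H u i j) (H' t i j) t)
    (Qp : Matrix ι κp ℝ) (hQpker : ∀ c : κp → ℝ, H t *ᵥ (Qp *ᵥ c) = 0)
    (hQp : ∀ c : κp → ℝ, c ≠ 0 → 0 < (Qp *ᵥ c) ⬝ᵥ H' t *ᵥ (Qp *ᵥ c))
    (Qm : Matrix ι κm ℝ) (hQmker : ∀ c : κm → ℝ, H t *ᵥ (Qm *ᵥ c) = 0)
    (hQm : ∀ c : κm → ℝ, c ≠ 0 → (Qm *ᵥ c) ⬝ᵥ H' t *ᵥ (Qm *ᵥ c) < 0)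
    (hreg : Fintype.card κp + Fintype.card κm = (univ.filter fun i => (hH t).eigenvalues i = 0).card) :
    (∀ᶠ u in 𝓝[<] t, (H u).det ≠ 0) ∧ (∀ᶠ u in 𝓝[>] t, (H u).det ≠ 0) := by
  have htot := card_eigenvalues_neg_add_zero_add_pos (hH t)
  constructor
  · have h1 := eventually_negCount_add_card_le_left H hH t H' hd Qp hQpker hQp
    have h2 := eventually_posCount_add_card_le_left H hH t H' hd Qm hQmker hQm
    refine (h1.and h2).mono fun u ⟨hu1, hu2⟩ => ?_
    rw [← zeroCount_eq_zero_iff_det_ne_zero (hH u)]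
    have := card_eigenvalues_neg_add_zero_add_pos (hH u)
    omega
  · have h1 := eventually_negCount_add_card_le_right H hH t H' hd Qm hQmker hQm
    have h2 := eventually_posCount_add_card_le_right H hH t H' hd Qp hQpker hQp
    refine (h1.and h2).mono fun u ⟨hu1, hu2⟩ => ?_
    rw [← zeroCount_eq_zero_iff_det_ne_zero (hH u)]
    have := card_eigenvalues_neg_add_zero_add_pos (hH u)
    omega

end Local

end SignedCrossing

end Summit.ValiantsHypothesis.ValiantsHypothesis.Theorems.KPlusLogSqLaw.TowerGraft
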